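import Literature.AlgebraicGeometry.Motives.ClosedGraphMorphism
import Literature.NumberTheory.Transcendental.AnalytificationProper
import Mathlib.AlgebraicGeometry.Morphisms.Immersion
import HarnessLib

/-!
# A closed graph with values in a locally closed subvariety is the graph of a morphism into it

Topic `AlgebraicGeometry/Motives`; namespace `Literature.AlgebraicGeometry.Motives`.  THEOREMS ONLY
(no definition, no named fact, no instance).  Generic node N3 of the census
`B-provers/B-p20/CENSUS-61-borel-via-chow.B-p20g4.md` (cell hodgecm-mathlib, row #61
`siegel_borel_extension`): the tree's Zariski-Main-Theorem step
`Motives.exists_hom_forall_comp_eq_of_isClosed` (a closed graph over a normal variety with values in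
a PROPER `K`-scheme `P` is the graph of a morphism `T ⟶ P`; Mumford, *Abelian Varieties* §4) is
upgraded to values in a LOCALLY CLOSED subscheme `e : V ↪ P` (an immersion): if every `K`-point of
the graph lies in `e(V)`, the morphism factors through `V`.

## The mathematics

Let `K` be algebraically closed of characteristic `0`, `T` an integral normal `K`-scheme locally of
finite type, `P` proper over `K`, `e : V ⟶ P` an immersion with `V` reduced and locally of finite
type, `φ₀ : T(K) → V(K)`, and `Γ ⊆ T ×_K P` closed with `Γ(K) = {(x, e(φ₀ x))}`.  The ZMT step
gives `ψ₀ : T ⟶ P` with `ψ₀(x) = e(φ₀ x)` on `K`-points.  Since `T` is Jacobson (finite type over a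
field: closed points are dense in every locally closed subset, Mathlib `nonempty_inter_closedPoints`)
and every closed point underlies a `K`-point (Nullstellensatz, the tree's
`AlgPoints.exists_pt_eq_of_isClosed`), the WHOLE image of `ψ₀` lies in the locally closed set
`e(V)` (`range_subset_of_isLocallyClosed_of_forall_pt_mem`).  Factor `e` as a closed immersion into
the open `coborder e(V)` (Mathlib `Scheme.Hom.liftCoborder`); lift `ψ₀` through the open part
(`IsOpenImmersion.lift`) and then through the closed part (`IsClosedImmersion.lift`, kernels compared
through ranges for REDUCED sources by the tree's `Scheme.Hom.ker_le_ker_of_range_subset_closure`).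
Points agree because immersions are monomorphisms.

## Main statements

* `range_subset_of_isLocallyClosed_of_forall_pt_mem` — Jacobson bookkeeping: a morphism from a
  `K`-scheme locally of finite type whose `K`-points land in a locally closed set lands in it.
* `exists_hom_forall_comp_eq_of_range_subset_of_isImmersion` — factoring a morphism from a reduced
  scheme through an immersion whose range contains its image.
* `exists_hom_forall_comp_eq_of_isClosed_of_isImmersion` — the closed-graph theorem with values in
  a locally closed subvariety.

## References
* [MumfordAV1970] D. Mumford, *Abelian Varieties*, §4 (morphisms and their graphs over a normal base).
* [GortzWedhorn2020] U. Görtz, T. Wedhorn, *Algebraic Geometry I*, 2nd ed., Prop. 3.35 (Jacobson /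
  very dense closed points), Rem. 9.12–9.13 (factoring through locally closed subschemes), §12.6
  (Zariski's main theorem).
* [StacksProject] Tag 01TB (schemes locally of finite type over a field are Jacobson).
-/

set_option autoImplicit false

noncomputable section

open CategoryTheory AlgebraicGeometry MonoidalCategory CartesianMonoidalCategory Topology

universe u

namespace Literature.AlgebraicGeometry.Motives

/-! ### §1 Jacobson bookkeeping: images are controlled by `K`-points -/

section Jacobson

variable {K : Type u} [Field K] [IsAlgClosed K] {T : SchemeOver K} [LocallyOfFiniteType T.hom]

/-- Over an algebraically closed field, a locally closed subset of a `K`-scheme locally of finite type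
which contains the underlying point of every `K`-point is everything (the scheme is Jacobson: a
non-empty locally closed subset contains a closed point, and closed points underlie `K`-points).
[cite: GortzWedhorn2020, Prop. 3.35] [cite: StacksProject, Tag 01TB] -/
theorem eq_univ_of_isLocallyClosed_of_forall_pt_mem {U : Set T.left} (hU : IsLocallyClosed U)
    (h : ∀ x : AlgPoints T K, x.pt ∈ U) : U = Set.univ := by
  have : JacobsonSpace T.left := LocallyOfFiniteType.jacobsonSpace T.hom
  -- if a locally closed `W` misses a point, its complement (locally closed when `W` is open or
  -- closed) contains a closed point, which underlies a `K`-point — impossible when `U ⊆ W`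
  have key : ∀ W : Set T.left, IsLocallyClosed Wᶜ → U ⊆ W → W = Set.univ := by
    intro W hW hUW
    by_contra hne
    have hc : (Wᶜ).Nonempty := by
      rw [Set.nonempty_compl]
      exact hne
    obtain ⟨t, htW, htcl⟩ := nonempty_inter_closedPoints hc hW
    obtain ⟨x, hx⟩ := AlgPoints.exists_pt_eq_of_isClosed (L := K) t htcl
    exact htW (hUW (hx ▸ h x))
  obtain ⟨O, Z, hO, hZ, rfl⟩ := hU
  have hO' : O = Set.univ := key O hO.isClosed_compl.isLocallyClosed Set.inter_subset_left
  have hZ' : Z = Set.univ := key Z (hZ.isOpen_compl.isLocallyClosed) Set.inter_subset_right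
  rw [hO', hZ', Set.univ_inter]

/-- A morphism from a `K`-scheme locally of finite type (`K` algebraically closed) all of whose
`K`-points map into a locally closed set `C` has its whole image inside `C`.
[cite: GortzWedhorn2020, Prop. 3.35] [cite: StacksProject, Tag 01TB] -/
theorem range_subset_of_isLocallyClosed_of_forall_pt_mem {S : Scheme.{u}} (g : T.left ⟶ S)
    {C : Set S} (hC : IsLocallyClosed C) (h : ∀ x : AlgPoints T K, g.base x.pt ∈ C) :
    Set.range g.base ⊆ C := by
  have hpre : IsLocallyClosed (g.base ⁻¹' C) := hC.preimage g.base.hom.continuous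
  have hall : g.base ⁻¹' C = Set.univ :=
    eq_univ_of_isLocallyClosed_of_forall_pt_mem (T := T) hpre fun x => h x
  rintro _ ⟨t, rfl⟩
  have ht : t ∈ g.base ⁻¹' C := by rw [hall]; exact Set.mem_univ t
  exact ht

end Jacobson

/-! ### §2 Factoring through an immersion -/

section Factor

variable {K : Type u} [Field K] {T V P : SchemeOver K}

/-- **Factoring through an immersion.** A morphism `g : T ⟶ P` of `K`-schemes from a REDUCED `T` whose
image lies in the range of an immersion `e : V ⟶ P` with `V` reduced factors through `e`
(closed part: kernels of morphisms from reduced schemes are determined by the closures of their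
images; open part: `IsOpenImmersion.lift`). [cite: GortzWedhorn2020, Rem. 9.12–9.13] -/
theorem exists_hom_comp_eq_of_range_subset_of_isImmersion [IsReduced T.left] [IsReduced V.left]
    (e : V ⟶ P) [IsImmersion e.left] (g : T ⟶ P)
    (h : Set.range g.left.base ⊆ Set.range e.left.base) : ∃ ψ : T ⟶ V, ψ ≫ e = g := by
  -- the open part: `g` lands in the coborder `O ⊇ e(V)` of the locally closed `e(V)`
  set O := e.left.coborderRange with hO
  have hgO : Set.range g.left.base ⊆ Set.range O.ι.base := by
    rw [Scheme.Opens.range_ι]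
    intro y hy
    exact subset_coborder (h hy)
  set g₁ : T.left ⟶ (O : Scheme.{u}) := IsOpenImmersion.lift O.ι g.left hgO with hg₁
  have hg₁fac : g₁ ≫ O.ι = g.left := IsOpenImmersion.lift_fac _ _ _
  -- the closed part: `e.liftCoborder : V ⟶ O` is a closed immersion and `g₁(T) ⊆ its range`
  have hrange : Set.range g₁.base ⊆ closure (Set.range e.left.liftCoborder.base) := by
    refine subset_closure.trans' ?_
    rintro _ ⟨t, rfl⟩
    obtain ⟨v, hv⟩ := h ⟨t, rfl⟩
    refine ⟨v, O.ι.isOpenEmbedding.injective ?_⟩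
    change (e.left.liftCoborder ≫ O.ι).base v = (g₁ ≫ O.ι).base t
    rw [Scheme.Hom.liftCoborder_ι, hg₁fac]
    exact hv
  have hker := Scheme.Hom.ker_le_ker_of_range_subset_closure e.left.liftCoborder g₁ hrange
  set ψ₁ : T.left ⟶ V.left := IsClosedImmersion.lift e.left.liftCoborder g₁ hker with hψ₁
  have hψ₁fac : ψ₁ ≫ e.left.liftCoborder = g₁ := IsClosedImmersion.lift_fac _ _ _
  have hψ₁e : ψ₁ ≫ e.left = g.left := by
    rw [← Scheme.Hom.liftCoborder_ι e.left, ← Category.assoc, hψ₁fac, hg₁fac]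
  refine ⟨Over.homMk ψ₁ ?_, ?_⟩
  · rw [← Over.w e, ← Category.assoc, hψ₁e, Over.w g]
  · ext : 1
    exact hψ₁e

end Factor

/-! ### §3 The closed-graph theorem with values in a locally closed subvariety -/

section Main

variable {K : Type u} [Field K] [IsAlgClosed K] [CharZero K] {T V P : SchemeOver K}
  [IsIntegral T.left] [LocallyOfFiniteType T.hom] [IsProper P.hom]
  [IsReduced V.left]

/-- **A closed graph with values in a locally closed subvariety is the graph of a morphism into it.**
`K` algebraically closed of characteristic `0`; `T` integral, normal, locally of finite type; `P`
proper; `e : V ⟶ P` an immersion with `V` reduced; `φ₀ : T(K) → V(K)`; `Γ ⊆ T ×_K P` closed with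
`K`-points exactly the pairs `(x, e(φ₀ x))`.  Then `φ₀` is induced by a morphism `ψ : T ⟶ V`.
Proof: `Motives.exists_hom_forall_comp_eq_of_isClosed` (Zariski's Main Theorem step) gives
`ψ₀ : T ⟶ P`; its image lies in `e(V)` by the Jacobson bookkeeping of §1; factor by §2; `e` is a
monomorphism. [cite: MumfordAV1970, §4] [cite: GortzWedhorn2020, §12.6 and Rem. 9.13] -/
theorem exists_hom_forall_comp_eq_of_isClosed_of_isImmersion
    (hTn : ∀ t : T.left, IsIntegrallyClosed (T.left.presheaf.stalk t))
    (e : V ⟶ P) [IsImmersion e.left]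
    (Γ : Set ↥(T ⊗ P).left) (hΓ : IsClosed Γ) (φ₀ : AlgPoints T K → AlgPoints V K)
    (hΓφ : ∀ (x : AlgPoints T K) (y : AlgPoints P K),
      AlgPoints.pt (lift x y : AlgPoints (T ⊗ P) K) ∈ Γ ↔ y = φ₀ x ≫ e) :
    ∃ ψ : T ⟶ V, ∀ x : AlgPoints T K, x ≫ ψ = φ₀ x := by
  -- Zariski's Main Theorem step, with values in the proper `P`
  obtain ⟨ψ₀, hψ₀⟩ :=
    exists_hom_forall_comp_eq_of_isClosed (T := T) (P := P) hTn Γ hΓ (fun x => φ₀ x ≫ e) hΓφ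
  -- every `K`-point of `T` maps into `e(V)`, hence so does all of `T` (Jacobson)
  have hpts : ∀ x : AlgPoints T K, ψ₀.left.base x.pt ∈ Set.range e.left.base := by
    intro x
    refine ⟨(φ₀ x).pt, ?_⟩
    change (AlgPoints.map e (φ₀ x)).pt = (AlgPoints.map ψ₀ x).pt
    rw [AlgPoints.map_apply, AlgPoints.map_apply, hψ₀ x]
  have hrange : Set.range ψ₀.left.base ⊆ Set.range e.left.base :=
    range_subset_of_isLocallyClosed_of_forall_pt_mem (T := T) ψ₀.left
      e.left.isLocallyClosed_range hpts
  -- factor through the immersion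
  obtain ⟨ψ, hψ⟩ := exists_hom_comp_eq_of_range_subset_of_isImmersion (T := T) e ψ₀ hrange
  refine ⟨ψ, fun x => ?_⟩
  -- points agree since `e` is a monomorphism
  haveI : Mono e.left := inferInstance
  have h1 : (x ≫ ψ) ≫ e = φ₀ x ≫ e := by rw [Category.assoc, hψ, hψ₀ x]
  ext : 1
  exact (cancel_mono e.left).1 (by simpa only [Over.comp_left, Category.assoc] using congrArg CommaMorphism.left h1)

end Main

end Literature.AlgebraicGeometry.Motives

end
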